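import Summits.KontsevichZagierPeriods.KontsevichZagierPeriods.Statement
import Summits.KontsevichZagierPeriods.KontsevichZagierPeriods.Theses.TorsionLogs
import Summits.KontsevichZagierPeriods.KontsevichZagierPeriods.Theorems.TorsionLogsNeronTorsionSector
import Summits.KontsevichZagierPeriods.KontsevichZagierPeriods.Theorems.TorsionLogsNeronTorsionFlexHeightChain
import Literature.NumberTheory.Transcendental.KZKernelConjectureForms
import Literature.NumberTheory.Transcendental.KZMoveFamily
import HarnessLib

/-!
# Route `TorsionLogs`, crux `TorsionSectorComplete` (stmt-KontsevichZagierPeriods-14212) — the rung of line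
# `NeronTorsionModularArc` as a Theorems-side object

The registered line `Cruxes/TorsionSectorComplete/Lines/NeronTorsionModularArc.lean` (forward generator, gen 16;
stubs `stub_arcEllipticChain` (XL), `stub_parametricLogCalculus` (M–L), `stub_arcSectorComplete` (residual);
composition `TorsionSectorComplete_of` proved) types its rung as the crux-workfile constant
`Cruxes.TorsionSectorComplete.NeronTorsionModularArc.NeronTorsionArcs`: the Néron–torsion chain of the proved
floor `NeronTorsionPrimitiveChain` integrated along a real arc `t₀ < t < t₁` of the pencil
`f_t(x) = 4x³ − t x − (4e₁³ − t e₁)` carrying a real `N`-torsion section (a real arc of `Y₁(N)`), as ONE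
pinned relation among four honest KZ-periods of dimensions `3, 3, 2, 2`.

Theorems files cannot import crux workfiles, and — unlike the rungs of the sister lines `NeronDuplication` /
`NeronHeight` (`TorsionLogsNeronTorsionFlexDefs.lean`) — this rung is phrased through crux-local vocabulary
(`pencil`, `fibreCurve`, `neronUnit`, `tangentDatum`, `logBox`, `box`, `ArcData`, `ArcReps`,
`NeronTorsionArcChain`, `NeronTorsionArcMember`).  This file is the Theorems-side mirror of that vocabulary,
VERBATIM (same bodies, same order), so that every mirrored constant is definitionally equal to its crux-side
namesake by `δ`-unfolding alone; in particular `NeronArcs.NeronTorsionArcs ≡ …NeronTorsionModularArc.NeronTorsionArcs`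
and `NeronArcs.ArcValueIdentity ≡ …NeronTorsionModularArc.ArcValueIdentity` (the on-path lander's target, the
modular-arc VALUE identity of `Lines/NeronTorsionArcs_onpath.lean`).  The value identity is PROVED in
`TorsionLogsTorsionSectorCompleteArcValue.lean` (raw fibre identity `TorsionLogsTorsionSectorCompleteArcFibreIdentity.lean`
+ last-coordinate Fubini / log boxes `TorsionLogsTorsionSectorCompleteArcFubini.lean`); the by-name F4 lemma
`KontsevichZagierPeriods → NeronTorsionArcs` with its `aesop` forward registration follows it.  Definitions only
here (plus the definitional bookkeeping `neronTorsionArcs_iff`, `rung_false`).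

prover-fwd2-land-1-g28-0 (on-path lander, candidates row 8), 2026-08-19.
-/

-- single-conjunct summit: Sub = Summit, so the namespace segment repeats by design (CONVENTIONS §2)
set_option linter.dupNamespace false

noncomputable section

open Set MeasureTheory
open Literature.NumberTheory.Transcendental
open Summit.KontsevichZagierPeriods.KontsevichZagierPeriods.Theses.TorsionLogs
  (NeronTorsionPrimitiveChain)

namespace Summit.KontsevichZagierPeriods.KontsevichZagierPeriods.TorsionLogs.NeronArcs

/-! ### Fibre data of the pencil through the 2-torsion abscissa `e₁` (verbatim mirror) -/

/-- The pencil cubic `f_t(x) = 4x³ − t x − (4e₁³ − t e₁) = (x − e₁)(4x² + 4e₁x + 4e₁² − t)`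
(`g₂ = t`, `g₃ = 4e₁³ − t e₁`).  Verbatim `…Cruxes.TorsionSectorComplete.NeronTorsionModularArc.pencil`. -/
def pencil (e₁ t x : ℝ) : ℝ := 4 * x ^ 3 - t * x - (4 * e₁ ^ 3 - t * e₁)

/-- Mathlib-normalised model `Y² = X³ − (t/4)X − g₃(t)/4` of the fibre (`y = 2Y`).
Verbatim `…NeronTorsionModularArc.fibreCurve`. -/
def fibreCurve (e₁ t : ℝ) : WeierstrassCurve ℝ := ⟨0, 0, 0, -t / 4, -(4 * e₁ ^ 3 - t * e₁) / 4⟩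

/-- The fibrewise Néron datum `A_N(t) = |ψ_{N−1}(x_P(t), y_P(t)/2)|` (division value at the torsion
section).  Verbatim `…NeronTorsionModularArc.neronUnit`. -/
def neronUnit (e₁ : ℝ) (N : ℕ) (xP : ℝ → ℝ) (t : ℝ) : ℝ :=
  |((fibreCurve e₁ t).ψ ((N : ℤ) - 1)).evalEval (xP t) (Real.sqrt (pencil e₁ t (xP t)) / 2)|

/-- The fibrewise tangent datum `D(t) = 3e₁² − g₂(t)/4 = f_t′(e₁)/4`.
Verbatim `…NeronTorsionModularArc.tangentDatum`. -/
def tangentDatum (e₁ t : ℝ) : ℝ := 3 * e₁ ^ 2 - t / 4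

/-- The "log box" integrand `(u, t) ↦ (B(t) − 1)/(1 + u (B(t) − 1))` on `0 < u < 1` (its `u`-integral is
`log B(t)` for `B(t) > 0`).  Verbatim `…NeronTorsionModularArc.logBox`. -/
def logBox (B : ℝ → ℝ) (w : Fin 2 → ℝ) : ℝ := (B (w 1) - 1) / (1 + w 0 * (B (w 1) - 1))

/-- The box `0 < u < 1`, `t₀ < t < t₁` (coordinates `w 0 = u`, `w 1 = t`).
Verbatim `…NeronTorsionModularArc.box`. -/
def box (t₀ t₁ : ℝ) : Set (Fin 2 → ℝ) := {w | 0 < w 0 ∧ w 0 < 1 ∧ t₀ < w 1 ∧ w 1 < t₁}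

/-! ### The statements (verbatim mirror) -/

/-- Hypotheses on the arc: fixed 2-torsion abscissa `e₁ > 0`, arc `t₀ < t < t₁` of the pencil on which
`Δ ≠ 0` and `e₁` is the largest root, and a real `N`-torsion section `x_P(t) > e₁` on the identity component
(`N ≥ 3`, `0 < a < N/2`, period relation `N·∫_{x_P(t)}^∞ dx/√f_t = a·ω₁(t)`).
Verbatim `…NeronTorsionModularArc.ArcData`. -/
def ArcData (e₁ t₀ t₁ : ℝ) (N a : ℕ) (xP : ℝ → ℝ) : Prop :=
  0 < e₁ ∧ t₀ < t₁ ∧ 3 ≤ N ∧ 0 < a ∧ 2 * a < N ∧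
  (∀ t ∈ Set.Ioo t₀ t₁, t ^ 3 - 27 * (4 * e₁ ^ 3 - t * e₁) ^ 2 ≠ 0) ∧
  (∀ t ∈ Set.Ioo t₀ t₁, ∀ x, e₁ < x → 0 < pencil e₁ t x) ∧
  (∀ t ∈ Set.Ioo t₀ t₁, e₁ < xP t) ∧
  (∀ t ∈ Set.Ioo t₀ t₁, ∀ hns : (fibreCurve e₁ t).toAffine.Nonsingular (xP t)
      (Real.sqrt (pencil e₁ t (xP t)) / 2),
    addOrderOf (WeierstrassCurve.Affine.Point.some (xP t) (Real.sqrt (pencil e₁ t (xP t)) / 2) hns) = N) ∧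
  (∀ t ∈ Set.Ioo t₀ t₁, (N : ℝ) * (∫ x in Set.Ioi (xP t), (Real.sqrt (pencil e₁ t x))⁻¹) =
    a * (2 * ∫ x in Set.Ioi e₁, (Real.sqrt (pencil e₁ t x))⁻¹))

/-- The two dimension-3 fibred representations over the arc (parameter `t = z 2` LAST):
`R_I = ∫_{t₀}^{t₁} ∫∫_{e₁<x′<x<x_P(t)} x′ dx′ dx dt/(√f_t(x′)√f_t(x))` and
`R_P = ∫_{t₀}^{t₁} ∫∫_{x,x′>e₁} (√f_t(x))⁻¹ (g₂(t)x′+2g₃(t)) dx dx′ dt/(2x′²√f_t(x′))`.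
Verbatim `…NeronTorsionModularArc.ArcReps`. -/
def ArcReps (e₁ t₀ t₁ : ℝ) (xP : ℝ → ℝ) (RI RP : KZ.IntegralRep 3) : Prop :=
  RI.domain = {z | t₀ < z 2 ∧ z 2 < t₁ ∧ e₁ < z 1 ∧ z 1 < z 0 ∧ z 0 < xP (z 2)} ∧
  Set.EqOn RI.integrand
    (fun z => z 1 / (Real.sqrt (pencil e₁ (z 2) (z 1)) * Real.sqrt (pencil e₁ (z 2) (z 0)))) RI.domain ∧
  RP.domain = {z | t₀ < z 2 ∧ z 2 < t₁ ∧ e₁ < z 0 ∧ e₁ < z 1} ∧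
  Set.EqOn RP.integrand
    (fun z => (Real.sqrt (pencil e₁ (z 2) (z 0)))⁻¹ *
      ((z 2 * z 1 + 2 * (4 * e₁ ^ 3 - z 2 * e₁)) / (2 * (z 1) ^ 2 * Real.sqrt (pencil e₁ (z 2) (z 1)))))
    RP.domain

/-- **Member `true` — the Néron–torsion chain along a modular arc** (pinned, value-free): for arc data and the
fibred representations `R_I`, `R_P` and the two log boxes `R_ψ = ∫∫ logBox A_N`, `R_D = ∫∫ logBox D` over the
arc, `(N−2)·4N²•[R_I] + (N−2)(N−2a)²•[R_P] − 4N•[R_ψ] + N²(N−2)•[R_D] ∈ KZ.relations`.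
Verbatim `…NeronTorsionModularArc.NeronTorsionArcChain`. -/
def NeronTorsionArcChain : Prop :=
  ∀ (e₁ t₀ t₁ : ℝ) (N a : ℕ) (xP : ℝ → ℝ), ArcData e₁ t₀ t₁ N a xP →
    ∀ (RI RP : KZ.IntegralRep 3) (Rψ RD : KZ.IntegralRep 2), ArcReps e₁ t₀ t₁ xP RI RP →
      Rψ.domain = box t₀ t₁ → Set.EqOn Rψ.integrand (logBox (neronUnit e₁ N xP)) Rψ.domain →
      RD.domain = box t₀ t₁ → Set.EqOn RD.integrand (logBox (tangentDatum e₁)) RD.domain →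
      (((N : ℤ) - 2) * (4 * (N : ℤ) ^ 2)) • KZ.of RI
        + (((N : ℤ) - 2) * ((N : ℤ) - 2 * (a : ℤ)) ^ 2) • KZ.of RP
        - (4 * (N : ℤ)) • KZ.of Rψ + ((N : ℤ) ^ 2 * ((N : ℤ) - 2)) • KZ.of RD ∈ KZ.relations

/-- **The family, graded by the base dimension `b`** (`false` ↦ one fibre — the floor decl
`Theses.TorsionLogs.NeronTorsionPrimitiveChain` VERBATIM; `true` ↦ an arc of `Y₁(N)`).
Verbatim `…NeronTorsionModularArc.NeronTorsionArcMember`. -/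
def NeronTorsionArcMember : Bool → Prop
  | false => NeronTorsionPrimitiveChain
  | true => NeronTorsionArcChain

/-- **THE RUNG `NeronTorsionArcs`** of line `NeronTorsionModularArc`, Theorems-side name: both base
dimensions.  Verbatim `…Cruxes.TorsionSectorComplete.NeronTorsionModularArc.NeronTorsionArcs` (definitionally
equal to it by `δ`-unfolding of the mirrored vocabulary). -/
def NeronTorsionArcs : Prop := ∀ b : Bool, NeronTorsionArcMember b

/-- **The modular-arc value identity** (real-analytic; the on-path lander's target):
`(N−2)(4N²·R_I.value + (N−2a)²·R_P.value) = 4N·R_ψ.value − N²(N−2)·R_D.value`.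
Verbatim `…NeronTorsionModularArc.ArcValueIdentity` (= `Lines/NeronTorsionArcs_onpath.lean :: ArcValueIdentity`);
proved in `TorsionLogsTorsionSectorCompleteArcValue.lean`. -/
def ArcValueIdentity : Prop :=
  ∀ (e₁ t₀ t₁ : ℝ) (N a : ℕ) (xP : ℝ → ℝ), ArcData e₁ t₀ t₁ N a xP →
    ∀ (RI RP : KZ.IntegralRep 3) (Rψ RD : KZ.IntegralRep 2), ArcReps e₁ t₀ t₁ xP RI RP →
      Rψ.domain = box t₀ t₁ → Set.EqOn Rψ.integrand (logBox (neronUnit e₁ N xP)) Rψ.domain →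
      RD.domain = box t₀ t₁ → Set.EqOn RD.integrand (logBox (tangentDatum e₁)) RD.domain →
      ((N : ℝ) - 2) * (4 * (N : ℝ) ^ 2 * RI.value + ((N : ℝ) - 2 * a) ^ 2 * RP.value) =
        4 * (N : ℝ) * Rψ.value - (N : ℝ) ^ 2 * ((N : ℝ) - 2) * RD.value

/-! ### Definitional bookkeeping -/

/-- The rung is the conjunction of its two members. [folklore] -/
theorem neronTorsionArcs_iff : NeronTorsionArcs ↔ NeronTorsionPrimitiveChain ∧ NeronTorsionArcChain := by
  constructor
  · intro h; exact ⟨h false, h true⟩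
  · rintro ⟨h₀, h₁⟩ b; cases b
    · exact h₀
    · exact h₁

/-- **F3: member `false` is the CLOSED floor** (the seed `stub_assembly`, by name). [folklore] -/
theorem rung_false : NeronTorsionArcMember false :=
  Summit.KontsevichZagierPeriods.KontsevichZagierPeriods.Cruxes.NeronTorsionSector.Translation.stub_assembly

end Summit.KontsevichZagierPeriods.KontsevichZagierPeriods.TorsionLogs.NeronArcs

end
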